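import Literature.MathematicalPhysics.QuantumFieldTheory.Balaban1983to89.B5SectBStatements
import Literature.MathematicalPhysics.QuantumFieldTheory.Balaban1983to89.B5Composition116
import Literature.MathematicalPhysics.QuantumFieldTheory.Balaban1983to89.B5Hk164Transl
import Literature.MathematicalPhysics.QuantumFieldTheory.Balaban1983to89.B5Hk163Form166

/-!
# `Balaban1983to89.B5TowerOneStroke` — T. Bałaban, *Propagators and renormalization transformations for lattice gauge
theories. I*, Commun. Math. Phys. **95** (1984) 17–40 [Balaban1984PropagatorsI], (1.16)–(1.18) p. 20, (1.47) p. 26,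
(1.64)–(1.65) p. 29: THE TOWER OF TORI OF `B5SectBStatements` IS THE ONE-STROKE TORUS of `B5Block118` — `towerM L M k`
is `fine (L^k) M`, the composite `Q_k = Q ∘ ⋯ ∘ Q` is the one-stroke `Q_k` of (1.18) (`QvOp (L^k) M`), `Q′_k` likewise
(`QsOp (L^k) M`), `S^η` is the curvature energy `cEnergy (L^k) M` with the (1.21) weight `η^d/2` — and, read through
this dictionary, the tree's minimiser `H_kB` of (1.47)/(1.63) gives «½⟨∂H_kB, ∂H_kB⟩» as THE MINIMUM OF THE ACTION
`S^η` OVER THE BLOCK-SPIN FIBRE `{A : Q_kA = B}` of the typed (1.17) integral, equal to `½⟨B, Δ_kB⟩` for the (1.65)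
operator of record `Beta.BlockEffectiveAction.DelK`

statement-level skeleton of published theorems with citation tags; proofs where landed; nothing here is a claim about the Yang–Mills mass gap

PDF held: `paper:balaban1984-cmp95-propagators-rt-i` (renders `run/shared/lean/pub/pub-balaban/b2b-balaban-ref1/pages/
1984-cmp95-propagators-rt-I/…-p004-x2.png` (p. 20), `…-p010-x2.png` (p. 26), `…-p013-x2.png` (p. 29), read as images).

**Source (verbatim; quotations LOCATE the statements).**
* p. 20 [PDF 4], after (1.16): «where z^{(2)} is a numerical factor coming from scaling transformations and Q₂ is
  defined as Q only with the number L replaced by L² in all definitions. It is easily seen that a composition of k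
  transformations is given by ((ST)^k e^{−S})(B) = z^{(k)}∫dA δ(B − Q_kA)δ_Ax(Q_{k−1}A)·…·δ_Ax(A)e^{−S^η(A)}, (1.17)
  where (Q_kA)_b = Σ_{x∈B^k(b₋)} η^{d+1}A([x, x(b)]), b ⊂ T₁^{(k)} = ℤ^d ∩ T_η, η = L^{−k}, (1.18)»; «or denoting
  (Q′_kλ)(y) = Σ_{x∈B^k(y)} η^dλ(x), we have Q_kA^λ = Q_kA − ∂Q′_kλ.» ((1.20)).
* p. 26 [PDF 10]: «With this integral an operator of fundamental importance is connected. It is defined on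
  configurations B on the lattice T₁^{(k)} and its value on such a configuration is equal to a configuration A on
  T_η minimizing the form ½⟨∂A, ∂A⟩ under the conditions Q_kA = B, R∂*A = 0.»
* p. 29 [PDF 13]: «H_kB is a minimum of ½⟨∂A, ∂A⟩ on the hyperplane {A : Q_kA = B, R∂*A = 0} … we get
  ((ST)^k e^{−S})(B) = Z_k exp(−½⟨∂H_kB, ∂H_kB⟩). (1.64)  The action Δ_k is thus defined by ⟨B, Δ_kB⟩ =
  ⟨∂H_kB, ∂H_kB⟩. (1.65)»; p. 21 [PDF 5]: «⟨∂A, ∂A⟩ = ½Σ_{x,μ,ν}η^d|F_{μν}(x)|²» ((1.21)).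

**Two typings of the same printed objects.**  The B5 owner's Sect. B statements (`B5SectBStatements`, seat r02) read
(1.16)/(1.17) literally as a COMPOSITION: level `k` of the tower of tori `towerM L M k` (`towerM (k+1) = fine L
(towerM k)`), `Qk L M k = Q ∘ ⋯ ∘ Q` (`Qlin L` at each level), `Qsk`, `actionEta L M k` (`= B5Action121.actionS`
with lattice factor `L^k` and weight `η^d`); the (1.17) integral `rt17`, its Gaussian evaluation (1.19)
`B5Eq114Gauss.DeltaK` and the hierarchical gauge (`B5HierGaugeTorus`) live there.  The tree's Sect. C–D objects —
the one-stroke averages `B5Block118.QvOp n M` / `QsOp n M` of (1.18)/(1.20) with `n = L^k`, the minimiser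
`B5Hk163Torus.HkOp n M` of (1.47)/(1.63) with its properties `B5Hk163RDiv.HkOp_minimum` (p. 29), the (1.65) operator
`Beta.BlockEffectiveAction.DelK` (`B5Hk163Form166.DelK_form_eq_formDk`, `form_DstarD_HkOp`; substrate
`BalabanHardMinimizer.DeltaK` by `DeltaK_eq_DelK`) — live on the torus `fine n M`.  The two-level composition law
`Q∘Q_{k−1} = Q_k` is the tree's `B5Composition116.QvOp_comp_mulVec` (through the site identification `sites`).
THIS FILE is the k-level dictionary between the two typings and its first consequence (interface row IF2-25 /
question Q-IF2-7 of the cell's INTERFACES.md, one-stroke side):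

* §1–§2 `towerM L M k ν = L^k·M ν` (`towerM_eq_fine`) and the canonical site identification `towerE L M k : Tor (towerM
  L M k) ≃ Tor (fine (L^k) M)` (a `B5Composition116.recast`, coherent with `sites (L^k) L M`: `towerE'_symm_apply`);
  fields read through it (`trC`, `trS`); the plaquette field (1.2), the action (1.3) and the one-step averages
  (1.11)/(1.13) are NATURAL under `recast` (`Fs_trC`, `actionS_trC`, `QvOp_trC`, `QsOp_trC`).
* §3 **(1.17)/(1.18) for the composite**: `cplx (Qk L M k A) = QvOp (L^k) M *ᵥ trC (towerE L M k) (cplx A)` for EVERY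
  `k` (`cplx_Qk`; induction over `QvOp_comp_mulVec`; base `QvOp 1 = id`, `QvOp_one_trC`), and `cplxS (Qsk L M k λ) =
  QsOp (L^k) M *ᵥ trS (towerE L M k) (cplxS λ)` (`cplxS_Qsk`) — «Q_k (Q′_k) is defined as Q (Q′) only with the number L
  replaced by L^k».
* §4 `actionEta L M k A = (η^d/2)·cEnergy (L^k) M (trC (towerE L M k) (cplx A))` (`actionEta_eq_cEnergy`; (1.3) with
  the (1.21) identity `B5Hk163RDiv.form_DstarD`), real parts (`reC`, `QvOp_mulVec_reC`, `cEnergy_reC_le`) and the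
  real field of the tower under a one-stroke field (`pullR`).
* §5 **THE MINIMUM OF THE ACTION OVER THE FIBRE** (p. 26/p. 29 for the typed (1.17) data): for every `k` and every
  unit-lattice field `B`, `IsLeast (S^η '' {A : Fld (towerM L M k) | Q_kA = B}) (½·formDk (L^k) M (cplx B))`
  (`isLeast_actionEta`): the lower bound is `HkOp_minimum` read through §3–§4, the minimum is ATTAINED at the tower
  field of (the real part of) `H_k(cplx B)` (`Qk_pullR_HkOp`, `actionEta_pullR_HkOp`); equivalently the least value is
  `½·(star B̃ ⬝ᵥ Δ_k B̃).re` for `Δ_k = Beta.BlockEffectiveAction.DelK (L^k) …` (`isLeast_actionEta_DelK`, by (1.65)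
  `DelK_form_eq_formDk`) and `(η^d/2)·cEnergy (H_kB̃)` = «½⟨∂H_kB, ∂H_kB⟩» with the (1.21) weight
  (`isLeast_actionEta_HkOp`); `sInf` forms.  No hypothesis on `d`; `L ≥ 1`.

NOT CERTIFIED HERE: the identity of this minimum with `½⟨B, Δ_kB⟩` for the GAUSSIAN `Δ_k` of (1.19)
(`B5Eq114Gauss.DeltaK`; announced by seat p16 gen 2, `B5Eq165DeltaK`), i.e. the tower side of IF2-25; the Landau
gauge condition and (1.47) itself (`B5Hk164Transl`, p16's `B5Eq147Landau`); any bridge for the V1-calculus one-stroke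
formula `B5Eq118OneStroke` (seat p39).  Helper facts carry the cite of the display they serve or `[folklore]`.

Unit `lit-balaban-p21` gen 3 (Phase-2 proof seat p21; literature-prover-lit-balaban-p21-g3-0), HOME
`run/shared/lean/pub/lit-balaban/` (STATUS: `lit-balaban-p21/STATUS.md`), 2026-08-21.  Owner r02, referee ref-4.
-/

namespace Literature.MathematicalPhysics.QuantumFieldTheory.Balaban1983to89.B5TowerOneStroke

open B5SectBStatements
open B5Prop11Plancherel (Tor fine unitVec)
open B5Block118 (bpt tstep up iota lineSum QvOp QsOp QvOp_mulVec QsOp_mulVec tstep_zero)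
open B5Composition116 (recast recast_apply recast_add recast_natCast recast_tstep up_natCast sites sitesV
  sitesV_symm_apply fine_fine QvOp_comp_mulVec QsOp_comp_mulVec)
open B5Action121 (Fs Fs_apply actionS actionS_eq_quarter)
open B5Hk164Transl (cEnergy cEnergy_eq)
open B5Hk163Torus (HkOp QvOp_HkOp_mulVec)
open B5Hk163RDiv (HkOp_minimum)
open B5Hk163Form166 (form_DstarD_HkOp DelK_form_eq_formDk)
open B5Bounds167Lattice (formDk)
open Beta.BlockEffectiveAction (DelK)
open scoped Matrix

noncomputable section

variable {d : ℕ}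

/-! ## §1  Site identifications `recast` (equal moduli): symmetry, composition, and what they fix -/

section Recast

variable {N N' N'' : Fin d → ℕ}

/-- the inverse identification is the identification along the reversed equalities. [cite: Balaban1984PropagatorsI, (1.18) p.20] -/
theorem recast_symm_apply (h : ∀ ν, N ν = N' ν) (x : Tor N') :
    (recast h).symm x = recast (fun ν => (h ν).symm) x := by
  funext ν
  show (ZMod.ringEquivCongr (h ν)).symm (x ν) = ZMod.ringEquivCongr ((h ν).symm) (x ν)
  rw [ZMod.ringEquivCongr_symm]

/-- identifications compose. [cite: Balaban1984PropagatorsI, (1.18) p.20] -/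
theorem recast_recast (h : ∀ ν, N ν = N' ν) (h' : ∀ ν, N' ν = N'' ν) (x : Tor N) :
    recast h' (recast h x) = recast (fun ν => (h ν).trans (h' ν)) x := by
  funext ν
  simp only [recast_apply]
  exact ZMod.ringEquivCongr_ringEquivCongr_apply (h ν) (h' ν) (x ν)

/-- `recast e_μ = e_μ`. [cite: Balaban1984PropagatorsI, (1.2) p.18] -/
theorem recast_unitVec (h : ∀ ν, N ν = N' ν) (μ : Fin d) : recast h (unitVec N μ) = unitVec N' μ := by
  funext ν
  rw [recast_apply]
  by_cases hν : ν = μ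
  · subst hν
    simp [unitVec]
  · simp [unitVec, hν]

/-- a (complex) vector field `A_μ(x)` read through a site identification `e`. [folklore] -/
def trC (e : Tor N ≃ Tor N') (A : Tor N × Fin d → ℂ) : Tor N' × Fin d → ℂ := fun i => A (e.symm i.1, i.2)

/-- a (complex) scalar function read through a site identification `e`. [folklore] -/
def trS (e : Tor N ≃ Tor N') (l : Tor N → ℂ) : Tor N' → ℂ := fun x => l (e.symm x)

/-- `(trC e A)_μ(e x) = A_μ(x)`. [cite: Balaban1984PropagatorsI, (1.18) p.20] -/
@[simp] theorem trC_apply (e : Tor N ≃ Tor N') (A : Tor N × Fin d → ℂ) (x : Tor N) (μ : Fin d) :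
    trC e A (e x, μ) = A (x, μ) := by
  simp [trC]

/-- `(trC e A)_μ(x′) = A_μ(e⁻¹x′)`. [cite: Balaban1984PropagatorsI, (1.18) p.20] -/
theorem trC_apply' (e : Tor N ≃ Tor N') (A : Tor N × Fin d → ℂ) (i : Tor N' × Fin d) :
    trC e A i = A (e.symm i.1, i.2) := rfl

/-- `(trS e λ)(e x) = λ(x)`. [cite: Balaban1984PropagatorsI, (1.20) p.20] -/
@[simp] theorem trS_apply (e : Tor N ≃ Tor N') (l : Tor N → ℂ) (x : Tor N) : trS e l (e x) = l x := by
  simp [trS]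

/-- `(trS e λ)(x′) = λ(e⁻¹x′)`. [cite: Balaban1984PropagatorsI, (1.20) p.20] -/
theorem trS_apply' (e : Tor N ≃ Tor N') (l : Tor N → ℂ) (x : Tor N') : trS e l x = l (e.symm x) := rfl

/-- equal coarse moduli give equal fine moduli `nN_ν = nN'_ν`. [cite: Balaban1984PropagatorsI, (1.18) p.20] -/
theorem fine_congr (n : ℕ) (h : ∀ ν, N ν = N' ν) : ∀ ν, fine n N ν = fine n N' ν :=
  fun ν => by
    show n * N ν = n * N' ν
    rw [h ν]

variable [hN : ∀ μ, NeZero (N μ)] [hN' : ∀ μ, NeZero (N' μ)]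

omit hN' in
/-- `recast (n·y) = n·(recast y)`: the scaled embedding `up` ((1.6) «x = ny + j») is natural. [cite: Balaban1984PropagatorsI, (1.6) p.18, (1.18) p.20] -/
theorem recast_up (n : ℕ) (h : ∀ ν, N ν = N' ν) (y : Tor N) :
    recast (fine_congr n h) (up n N y) = up n N' (recast h y) := by
  have hy : y = fun ν => (((y ν).val : ℕ) : ZMod (N ν)) := funext fun ν => (ZMod.natCast_zmod_val _).symm
  rw [hy, up_natCast, recast_natCast, recast_natCast, up_natCast]

omit hN hN' in
/-- `recast` fixes the block offsets `j`. [cite: Balaban1984PropagatorsI, (1.6) p.18, (1.18) p.20] -/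
theorem recast_iota (n : ℕ) (h : ∀ ν, N ν = N' ν) (j : Fin d → Fin n) :
    recast (fine_congr n h) (iota n N j) = iota n N' j :=
  recast_natCast (fine_congr n h) fun ν => (j ν : ℕ)

omit hN' in
/-- `recast` maps the block point `ny + j` to the block point `n(recast y) + j` («B^k(y)», (1.6)/(1.18)).
[cite: Balaban1984PropagatorsI, (1.18) p.20] -/
theorem recast_bpt (n : ℕ) (h : ∀ ν, N ν = N' ν) (y : Tor N) (j : Fin d → Fin n) :
    recast (fine_congr n h) (bpt n N y j) = bpt n N' (recast h y) j := by
  rw [bpt, bpt, recast_add, recast_up n h, recast_iota n h]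

/-- the plaquette field (1.2) is natural under `recast`: `F_{μν}[trC A](recast x) = F_{μν}[A](x)`.
[cite: Balaban1984PropagatorsI, (1.2) p.18] -/
theorem Fs_trC (h : ∀ ν, N ν = N' ν) (c : ℂ) (A : Tor N × Fin d → ℂ) (μ ν : Fin d) (x : Tor N) :
    Fs N' c (trC (recast h) A) μ ν (recast h x) = Fs N c A μ ν x := by
  simp only [Fs_apply, ← recast_unitVec h, ← recast_add, trC_apply]

/-- the action (1.3) is natural under `recast`: `S[trC A] = S[A]` (same lattice factor and weight).
[cite: Balaban1984PropagatorsI, (1.3) p.18] -/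
theorem actionS_trC (h : ∀ ν, N ν = N' ν) (c : ℂ) (w : ℝ) (A : Tor N × Fin d → ℂ) :
    actionS N' c w (trC (recast h) A) = actionS N c w A := by
  rw [actionS, actionS, ← Equiv.sum_comp (recast h)]
  simp only [Fs_trC]

/-- the one-step vector average (1.11)/(1.18) is natural under `recast` of the coarse torus (and the induced `recast`
of the fine one): `Q_n (trC A) = trC (Q_n A)`. [cite: Balaban1984PropagatorsI, (1.18) p.20] -/
theorem QvOp_trC (n : ℕ) [NeZero n] (h : ∀ ν, N ν = N' ν) (A : Tor (fine n N) × Fin d → ℂ) :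
    QvOp n N' *ᵥ trC (recast (fine_congr n h)) A = trC (recast h) (QvOp n N *ᵥ A) := by
  funext i
  obtain ⟨y', μ⟩ := i
  obtain ⟨y, rfl⟩ : ∃ y, recast h y = y' := ⟨(recast h).symm y', Equiv.apply_symm_apply _ _⟩
  rw [trC_apply, QvOp_mulVec, QvOp_mulVec]
  simp only [lineSum, ← recast_bpt, ← recast_tstep (fine_congr n h), ← recast_add, trC_apply]

/-- the one-step scalar average (1.13)/(1.20) is natural under `recast`: `Q′_n (trS λ) = trS (Q′_n λ)`.
[cite: Balaban1984PropagatorsI, (1.20) p.20] -/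
theorem QsOp_trS (n : ℕ) [NeZero n] (h : ∀ ν, N ν = N' ν) (l : Tor (fine n N) → ℂ) :
    QsOp n N' *ᵥ trS (recast (fine_congr n h)) l = trS (recast h) (QsOp n N *ᵥ l) := by
  funext y'
  obtain ⟨y, rfl⟩ : ∃ y, recast h y = y' := ⟨(recast h).symm y', Equiv.apply_symm_apply _ _⟩
  rw [trS_apply, QsOp_mulVec, QsOp_mulVec]
  simp only [← recast_bpt, trS_apply]

end Recast

/-! ## §2  The tower of tori is the one-stroke torus: `towerM L M k = fine (L^k) M` -/

section Tower

variable (L : ℕ) (M : Fin d → ℕ)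

/-- `towerM L M k` has `L^k·M_ν` sites in direction `ν` — the moduli of `fine (L^k) M` («η = L^{−k}», (1.18)).
[cite: Balaban1984PropagatorsI, (1.18) p.20] -/
theorem towerM_eq_fine : ∀ (k : ℕ) (ν : Fin d), towerM L M k ν = fine (L ^ k) M ν
  | 0, ν => by
      show M ν = L ^ 0 * M ν
      rw [pow_zero, one_mul]
  | k + 1, ν => by
      show L * towerM L M k ν = L ^ (k + 1) * M ν
      rw [towerM_eq_fine k ν]
      show L * (L ^ k * M ν) = L ^ (k + 1) * M ν
      ring

/-- **the site identification of level `k` of the tower with the one-stroke torus `T_η`, `η = L^{−k}`.**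
[cite: Balaban1984PropagatorsI, (1.18) p.20] -/
def towerE (k : ℕ) : Tor (towerM L M k) ≃ Tor (fine (L ^ k) M) := recast (towerM_eq_fine L M k)

/-- `towerE k` is the `recast` along `towerM_eq_fine`. [cite: Balaban1984PropagatorsI, (1.18) p.20] -/
theorem towerE_eq (k : ℕ) : towerE L M k = recast (towerM_eq_fine L M k) := rfl

/-- level `k+1` of the tower read on `T_{(L^k·L)⁻¹}`: the same map as `towerE L M (k+1)` (`towerE_succ`), TYPED on the
moduli `fine (L^k * L) M` of the composition law `B5Composition116.QvOp_comp_mulVec`. [folklore] -/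
def towerE' (k : ℕ) : Tor (towerM L M (k + 1)) ≃ Tor (fine (L ^ k * L) M) := recast (towerM_eq_fine L M (k + 1))

/-- `towerE (k+1) = towerE' k` (`L^{k+1} = L^k·L`). [cite: Balaban1984PropagatorsI, (1.16)–(1.18) p.20] -/
theorem towerE_succ (k : ℕ) : towerE L M (k + 1) = towerE' L M k := rfl

/-- COHERENCE with the nesting identification `sites (L^k) L M` of `B5Composition116`: reading level `k+1` of the tower
on `T_{(L^kL)⁻¹}` IS reading it as the `L`-refinement of (level `k` read on `T_{L^{−k}}`).
[cite: Balaban1984PropagatorsI, (1.16)–(1.18) p.20] -/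
theorem towerE'_symm_apply (k : ℕ) (x : Tor (fine (L ^ k * L) M)) :
    (towerE' L M k).symm x = (recast (fine_congr L (towerM_eq_fine L M k))).symm (sites (L ^ k) L M x) := by
  rw [towerE', recast_symm_apply, recast_symm_apply, sites, recast_recast]
  rfl

/-- the real field of level `k` of the tower whose reading on `T_η` is the real part of a given one-stroke field.
[folklore] -/
def pullR (k : ℕ) (A' : Tor (fine (L ^ k) M) × Fin d → ℂ) : Fld (towerM L M k) :=
  WithLp.toLp 2 fun i => (A' (towerE L M k i.1, i.2)).re

/-- components of `pullR`. [cite: Balaban1984PropagatorsI, (1.17) p.20] -/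
theorem pullR_apply (k : ℕ) (A' : Tor (fine (L ^ k) M) × Fin d → ℂ) (i : Tor (towerM L M k) × Fin d) :
    pullR L M k A' i = (A' (towerE L M k i.1, i.2)).re := rfl

variable [NeZero L] [hM : ∀ μ, NeZero (M μ)]

/-- `up` by the factor `1` is the identification `T ≃ T_{1⁻¹}`. [cite: Balaban1984PropagatorsI, (1.6) p.18] -/
theorem up_one (h : ∀ ν, M ν = fine 1 M ν) (y : Tor M) : up 1 M y = recast h y := by
  have hy : y = fun ν => (((y ν).val : ℕ) : ZMod (M ν)) := funext fun ν => (ZMod.natCast_zmod_val _).symm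
  rw [hy, up_natCast, recast_natCast]
  simp only [one_mul]

/-- averaging over blocks of ONE site is the identity: `Q_1 (trC A) = A`. [cite: Balaban1984PropagatorsI, (1.18) p.20] -/
theorem QvOp_one_trC (h : ∀ ν, M ν = fine 1 M ν) (B : Tor M × Fin d → ℂ) :
    QvOp 1 M *ᵥ trC (recast h) B = B := by
  funext i
  obtain ⟨y, μ⟩ := i
  rw [QvOp_mulVec]
  simp only [lineSum, Finset.univ_unique, Finset.sum_singleton, Nat.cast_one, one_pow, div_one, one_mul]
  have hι : iota 1 M (default : Fin d → Fin 1) = 0 := by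
    funext ν
    simp [iota]
  have ht : tstep (fine 1 M) μ ((default : Fin 1) : ℕ) = 0 := by
    rw [Fin.val_eq_zero, tstep_zero]
  rw [bpt, hι, ht, add_zero, add_zero, up_one M h, trC_apply]

/-- `Q′_1 (trS λ) = λ`. [cite: Balaban1984PropagatorsI, (1.20) p.20] -/
theorem QsOp_one_trS (h : ∀ ν, M ν = fine 1 M ν) (l : Tor M → ℂ) :
    QsOp 1 M *ᵥ trS (recast h) l = l := by
  funext y
  rw [QsOp_mulVec]
  simp only [Finset.univ_unique, Finset.sum_singleton, Nat.cast_one, one_pow, div_one, one_mul]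
  have hι : iota 1 M (default : Fin d → Fin 1) = 0 := by
    funext ν
    simp [iota]
  rw [bpt, hι, add_zero, up_one M h, trS_apply]

/-! ## §3  (1.17)/(1.18): the composite `Q_k` of the tower is the one-stroke `Q_k`, every `k` -/

/-- one step of the tower read on the one-stroke tori: `trC_k (Q A) = Q (trC A)` between levels `k+1 → k`.
[cite: Balaban1984PropagatorsI, (1.16)–(1.18) p.20] -/
theorem QvOp_towerE (k : ℕ) (A : Tor (fine L (towerM L M k)) × Fin d → ℂ) :
    trC (towerE L M k) (QvOp L (towerM L M k) *ᵥ A)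
      = QvOp L (fine (L ^ k) M) *ᵥ trC (recast (fine_congr L (towerM_eq_fine L M k))) A :=
  (QvOp_trC L (towerM_eq_fine L M k) A).symm

/-- the same for the scalar average. [cite: Balaban1984PropagatorsI, (1.20) p.20] -/
theorem QsOp_towerE (k : ℕ) (l : Tor (fine L (towerM L M k)) → ℂ) :
    trS (towerE L M k) (QsOp L (towerM L M k) *ᵥ l)
      = QsOp L (fine (L ^ k) M) *ᵥ trS (recast (fine_congr L (towerM_eq_fine L M k))) l :=
  (QsOp_trS L (towerM_eq_fine L M k) l).symm


/-- **«Q_k is defined as Q only with the number L replaced by L^k»** for the B5 owner's COMPOSITE `Qk L M k = Q∘⋯∘Q`: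
read through `towerE`, `Q_kA` is the one-stroke average (1.18) `B5Block118.QvOp (L^k) M` of `A`, for every `k`
(induction over the two-level law `B5Composition116.QvOp_comp_mulVec`). [cite: Balaban1984PropagatorsI, (1.17)–(1.18) p.20] -/
theorem cplx_Qk : ∀ (k : ℕ) (A : Fld (towerM L M k)),
    cplx (Qk L M k A) = QvOp (L ^ k) M *ᵥ trC (towerE L M k) (cplx A)
  | 0, A => (QvOp_one_trC M (towerM_eq_fine L M 0) (cplx A)).symm
  | k + 1, A => by
      show cplx (Qk L M k (Qlin L (towerM L M k) A)) = QvOp (L ^ k * L) M *ᵥ trC (towerE' L M k) (cplx A)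
      have hA : trC (recast (fine_congr L (towerM_eq_fine L M k))) (cplx A)
          = trC (towerE' L M k) (cplx A) ∘ (sitesV (L ^ k) L M).symm := by
        funext i
        obtain ⟨x, ν⟩ := i
        simp only [Function.comp_apply, sitesV_symm_apply, trC_apply', towerE'_symm_apply, Equiv.apply_symm_apply]
        rfl
      funext i
      obtain ⟨y, μ⟩ := i
      rw [cplx_Qk k, cplx_Qlin, QvOp_towerE, hA, QvOp_comp_mulVec]

/-- the same for the scalar averages: the composite `Q′_k` of the tower is the one-stroke `Q′_k` of (1.20),
`B5Block118.QsOp (L^k) M`. [cite: Balaban1984PropagatorsI, (1.20) p.20] -/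
theorem cplxS_Qsk : ∀ (k : ℕ) (l : Scl (towerM L M k)),
    cplxS (Qsk L M k l) = QsOp (L ^ k) M *ᵥ trS (towerE L M k) (cplxS l)
  | 0, l => (QsOp_one_trS M (towerM_eq_fine L M 0) (cplxS l)).symm
  | k + 1, l => by
      show cplxS (Qsk L M k (QsLin L (towerM L M k) l)) = QsOp (L ^ k * L) M *ᵥ trS (towerE' L M k) (cplxS l)
      have hl : trS (recast (fine_congr L (towerM_eq_fine L M k))) (cplxS l)
          = trS (towerE' L M k) (cplxS l) ∘ (sites (L ^ k) L M).symm := by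
        funext x
        simp only [Function.comp_apply, trS_apply', towerE'_symm_apply, Equiv.apply_symm_apply]
        rfl
      funext y
      rw [cplxS_Qsk k, cplxS_QsLin, QsOp_towerE, hl, QsOp_comp_mulVec]

/-- hence the block-spin fibre of the tower maps into the one-stroke fibre: `Q_kA = B ⇒ Q_k(trC A) = cplx B`.
[cite: Balaban1984PropagatorsI, (1.17)–(1.18) p.20] -/
theorem QvOp_trC_of_Qk_eq (k : ℕ) {A : Fld (towerM L M k)} {B : Fld M} (hA : Qk L M k A = B) :
    QvOp (L ^ k) M *ᵥ trC (towerE L M k) (cplx A) = cplx B := by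
  rw [← cplx_Qk, hA]

/-! ## §4  The action of the tower is the one-stroke curvature energy; real parts -/

/-- `η^d·(L^k)^d = 1`. [cite: Balaban1984PropagatorsI, (1.18) p.20] -/
theorem eta_pow_mul_pow (k : ℕ) : eta L k ^ d * (((L ^ k : ℕ) : ℝ)) ^ d = 1 := by
  have hL : ((L : ℝ)) ^ k ≠ 0 := pow_ne_zero k (Nat.cast_ne_zero.mpr (NeZero.ne L))
  rw [eta, Nat.cast_pow, ← mul_pow, inv_mul_cancel₀ hL, one_pow]

/-- `(η^d/2)·((L^k)^d·t) = t/2`. [cite: Balaban1984PropagatorsI, (1.18) p.20, (1.21) p.21] -/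
theorem eta_half_mul (k : ℕ) (t : ℝ) : eta L k ^ d / 2 * ((((L ^ k : ℕ) : ℝ)) ^ d * t) = 1 / 2 * t := by
  rw [show eta L k ^ d / 2 * ((((L ^ k : ℕ) : ℝ)) ^ d * t) = eta L k ^ d * (((L ^ k : ℕ) : ℝ)) ^ d * t / 2 by ring,
    eta_pow_mul_pow]
  ring

/-- (1.3) with the (1.21) identity: on `T_η` (`n` sites per unit), `S = (w/2)·cEnergy` for the weight `w`
(`cEnergy A = ½Σ_{x,μ,ν}|F_{μν}[A](x)|²`, `B5Hk164Transl.cEnergy_eq`). [cite: Balaban1984PropagatorsI, (1.21) p.21] -/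
theorem actionS_eq_mul_cEnergy (n : ℕ) [NeZero n] (w : ℝ) (A : Tor (fine n M) × Fin d → ℂ) :
    actionS (fine n M) (n : ℂ) w A = w / 2 * cEnergy n M A := by
  rw [actionS_eq_quarter, cEnergy_eq]
  simp only [← Finset.mul_sum]
  ring

/-- **`S^η(A) = (η^d/2)·cEnergy (L^k) M (trC A)`**: the tower action of `B5SectBStatements` is the one-stroke curvature
energy with the (1.21) weight. [cite: Balaban1984PropagatorsI, (1.3) p.18, (1.21) p.21] -/
theorem actionEta_eq_cEnergy (k : ℕ) (A : Fld (towerM L M k)) :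
    actionEta L M k A = eta L k ^ d / 2 * cEnergy (L ^ k) M (trC (towerE L M k) (cplx A)) := by
  rw [← actionS_eq_mul_cEnergy, actionEta, towerE, actionS_trC, Nat.cast_pow]

/-- the curvature energy of the minimiser: `cEnergy (H_kB) = n^d·formDk B` ((1.65) for the typed `H_k`,
`B5Hk163Form166.form_DstarD_HkOp`). [cite: Balaban1984PropagatorsI, (1.65) p.29] -/
theorem cEnergy_HkOp (n : ℕ) [NeZero n] (B : Tor M × Fin d → ℂ) :
    cEnergy n M (HkOp n M *ᵥ B) = ((n : ℝ)) ^ d * formDk n M B := by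
  rw [cEnergy, form_DstarD_HkOp, Complex.ofReal_re]

/-- the real part of a complex field, as a complex field. [folklore] -/
def reC {ι : Type*} (f : ι → ℂ) : ι → ℂ := fun i => (((f i).re : ℝ) : ℂ)

/-- `reC` acts pointwise. [cite: Balaban1984PropagatorsI, (1.1) p.18] -/
theorem reC_apply {ι : Type*} (f : ι → ℂ) (i : ι) : reC f i = (((f i).re : ℝ) : ℂ) := rfl

/-- a real field is its own real part. [cite: Balaban1984PropagatorsI, (1.1) p.18] -/
theorem reC_cplx {N : Fin d → ℕ} (B : Fld N) : reC (cplx B) = cplx B := by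
  funext i
  simp [reC, cplx]

/-- the one-stroke average has REAL coefficients: `Q_k(Re A) = Re(Q_kA)`. [cite: Balaban1984PropagatorsI, (1.18) p.20] -/
theorem QvOp_mulVec_reC (n : ℕ) [NeZero n] (A : Tor (fine n M) × Fin d → ℂ) :
    QvOp n M *ᵥ reC A = reC (QvOp n M *ᵥ A) := by
  funext i
  obtain ⟨y, μ⟩ := i
  rw [reC_apply, QvOp_mulVec, QvOp_mulVec]
  have hc : (1 / (n : ℂ) ^ (d + 1)) = (((1 / (n : ℝ) ^ (d + 1) : ℝ)) : ℂ) := by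
    push_cast
    ring
  rw [hc, Complex.re_ofReal_mul]
  simp only [lineSum, reC_apply, Complex.re_sum]
  push_cast
  rfl

/-- the plaquette field has REAL coefficients: `F_{μν}[Re A] = Re F_{μν}[A]`. [cite: Balaban1984PropagatorsI, (1.2) p.18] -/
theorem Fs_reC {N : Fin d → ℕ} [∀ μ, NeZero (N μ)] (n : ℕ) (A : Tor N × Fin d → ℂ) (μ ν : Fin d) (x : Tor N) :
    Fs N (n : ℂ) (reC A) μ ν x = (((Fs N (n : ℂ) A μ ν x).re : ℝ) : ℂ) := by
  rw [Fs_apply, Fs_apply, ← Complex.ofReal_natCast, Complex.re_ofReal_mul]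
  simp only [reC_apply, Complex.add_re, Complex.sub_re]
  push_cast
  ring

/-- taking real parts does not increase the curvature energy. [cite: Balaban1984PropagatorsI, (1.21) p.21] -/
theorem cEnergy_reC_le (n : ℕ) [NeZero n] (A : Tor (fine n M) × Fin d → ℂ) :
    cEnergy n M (reC A) ≤ cEnergy n M A := by
  rw [cEnergy_eq, cEnergy_eq]
  refine mul_le_mul_of_nonneg_left ?_ (by norm_num)
  refine Finset.sum_le_sum fun x _ => Finset.sum_le_sum fun μ _ => Finset.sum_le_sum fun ν _ => ?_
  rw [Fs_reC]
  refine pow_le_pow_left₀ (norm_nonneg _) ?_ 2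
  rw [Complex.norm_real, Real.norm_eq_abs]
  exact Complex.abs_re_le_norm _

omit [NeZero L] hM in
/-- `pullR A'` read on `T_η` is `Re A'`. [cite: Balaban1984PropagatorsI, (1.17) p.20] -/
theorem trC_cplx_pullR (k : ℕ) (A' : Tor (fine (L ^ k) M) × Fin d → ℂ) :
    trC (towerE L M k) (cplx (pullR L M k A')) = reC A' := by
  funext i
  obtain ⟨x, μ⟩ := i
  rw [trC_apply', reC_apply]
  simp only [cplx, pullR_apply, Equiv.apply_symm_apply]

/-- `S^η(pullR A') = (η^d/2)·cEnergy (Re A') ≤ (η^d/2)·cEnergy A'`. [cite: Balaban1984PropagatorsI, (1.21) p.21] -/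
theorem actionEta_pullR_le (k : ℕ) (A' : Tor (fine (L ^ k) M) × Fin d → ℂ) :
    actionEta L M k (pullR L M k A') ≤ eta L k ^ d / 2 * cEnergy (L ^ k) M A' := by
  rw [actionEta_eq_cEnergy, trC_cplx_pullR]
  exact mul_le_mul_of_nonneg_left (cEnergy_reC_le M (L ^ k) A') (by rw [eta]; positivity)

/-- the pull-back of a one-stroke field over `cplx B` lies in the fibre of `B`: `Q_k(pullR A') = B`.
[cite: Balaban1984PropagatorsI, (1.17)–(1.18) p.20] -/
theorem Qk_pullR (k : ℕ) {A' : Tor (fine (L ^ k) M) × Fin d → ℂ} {B : Fld M} (hA' : QvOp (L ^ k) M *ᵥ A' = cplx B) :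
    Qk L M k (pullR L M k A') = B := by
  apply cplx_injective
  rw [cplx_Qk, trC_cplx_pullR, QvOp_mulVec_reC, hA', reC_cplx]

/-! ## §5  The minimum of the action over the block-spin fibre `{A : Q_kA = B}` -/

/-- **LOWER BOUND**: `½·formDk (L^k) M (cplx B) ≤ S^η(A)` for every tower field `A` with `Q_kA = B` — the minimum
property of `H_kB` (p. 29, `B5Hk163RDiv.HkOp_minimum`) read through §3–§4 and (1.65) (`form_DstarD_HkOp`).
[cite: Balaban1984PropagatorsI, (1.47) p.26, (1.64)–(1.65) p.29] -/
theorem half_formDk_le_actionEta (k : ℕ) (B : Fld M) (A : Fld (towerM L M k)) (hA : Qk L M k A = B) :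
    1 / 2 * formDk (L ^ k) M (cplx B) ≤ actionEta L M k A := by
  have hmin : cEnergy (L ^ k) M (HkOp (L ^ k) M *ᵥ cplx B) ≤ cEnergy (L ^ k) M (trC (towerE L M k) (cplx A)) :=
    HkOp_minimum (L ^ k) M (cplx B) _ (QvOp_trC_of_Qk_eq L M k hA)
  rw [cEnergy_HkOp] at hmin
  have hpos : 0 ≤ eta L k ^ d / 2 := by rw [eta]; positivity
  calc 1 / 2 * formDk (L ^ k) M (cplx B)
      = eta L k ^ d / 2 * ((((L ^ k : ℕ) : ℝ)) ^ d * formDk (L ^ k) M (cplx B)) := (eta_half_mul L k _).symm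
    _ ≤ eta L k ^ d / 2 * cEnergy (L ^ k) M (trC (towerE L M k) (cplx A)) := mul_le_mul_of_nonneg_left hmin hpos
    _ = actionEta L M k A := (actionEta_eq_cEnergy L M k A).symm

/-- the tower field of the real part of `H_k(cplx B)` lies in the fibre of `B`.
[cite: Balaban1984PropagatorsI, p.29 «Q_kH_kB = B»] -/
theorem Qk_pullR_HkOp (k : ℕ) (B : Fld M) : Qk L M k (pullR L M k (HkOp (L ^ k) M *ᵥ cplx B)) = B :=
  Qk_pullR L M k (QvOp_HkOp_mulVec (L ^ k) M (cplx B))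

/-- **THE MINIMUM IS ATTAINED** at the tower field of (the real part of) `H_k(cplx B)`:
`S^η(pullR (H_k B̃)) = ½·formDk B̃`. [cite: Balaban1984PropagatorsI, (1.64)–(1.65) p.29] -/
theorem actionEta_pullR_HkOp (k : ℕ) (B : Fld M) :
    actionEta L M k (pullR L M k (HkOp (L ^ k) M *ᵥ cplx B)) = 1 / 2 * formDk (L ^ k) M (cplx B) := by
  refine le_antisymm ?_ (half_formDk_le_actionEta L M k B _ (Qk_pullR_HkOp L M k B))
  calc actionEta L M k (pullR L M k (HkOp (L ^ k) M *ᵥ cplx B))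
      ≤ eta L k ^ d / 2 * cEnergy (L ^ k) M (HkOp (L ^ k) M *ᵥ cplx B) := actionEta_pullR_le L M k _
    _ = 1 / 2 * formDk (L ^ k) M (cplx B) := by rw [cEnergy_HkOp, eta_half_mul]

/-- **THE MINIMUM OF THE ACTION OVER THE BLOCK-SPIN FIBRE** of the typed (1.17) integral: for every `k` and every
unit-lattice field `B`, `min {S^η(A) : A on level k, Q_kA = B} = ½·formDk (L^k) M (cplx B)` — EXISTS and equals the
(1.65)/(1.66) form of the tree (`B5Bounds167Lattice.formDk`, `B5Hk163Form166`).  «its value on such a configuration is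
equal to a configuration A on T_η minimizing the form ½⟨∂A, ∂A⟩ under the conditions Q_kA = B, …» (p. 26); «H_kB is a
minimum of ½⟨∂A, ∂A⟩ on the hyperplane» (p. 29). [cite: Balaban1984PropagatorsI, (1.47) p.26, (1.64)–(1.65) p.29] -/
theorem isLeast_actionEta (k : ℕ) (B : Fld M) :
    IsLeast (actionEta L M k '' {A | Qk L M k A = B}) (1 / 2 * formDk (L ^ k) M (cplx B)) := by
  refine ⟨⟨pullR L M k (HkOp (L ^ k) M *ᵥ cplx B), Qk_pullR_HkOp L M k B, actionEta_pullR_HkOp L M k B⟩, ?_⟩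
  rintro _ ⟨A, hA, rfl⟩
  exact half_formDk_le_actionEta L M k B A hA

/-- the same with `inf`. [cite: Balaban1984PropagatorsI, (1.47) p.26, (1.64)–(1.65) p.29] -/
theorem sInf_actionEta (k : ℕ) (B : Fld M) :
    sInf (actionEta L M k '' {A | Qk L M k A = B}) = 1 / 2 * formDk (L ^ k) M (cplx B) :=
  (isLeast_actionEta L M k B).csInf_eq

/-- **(1.65) reading**: the minimum of `S^η` over `{Q_kA = B}` is `½⟨B̃, Δ_kB̃⟩` for the (1.65) operator of record
`Δ_k = Beta.BlockEffectiveAction.DelK (L^k) …` (`B̃ = cplx B`; substrate `BalabanHardMinimizer.DeltaK` by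
`DeltaK_eq_DelK`), for every admissible `a` (the form does not depend on it, `DelK_form_eq_formDk`).
[cite: Balaban1984PropagatorsI, (1.65) p.29] -/
theorem isLeast_actionEta_DelK (k : ℕ) (hn : 1 ≤ L ^ k) (a : ℝ) (ha : 0 < a) (B : Fld M) :
    IsLeast (actionEta L M k '' {A | Qk L M k A = B})
      (1 / 2 * (star (cplx B) ⬝ᵥ (DelK (L ^ k) hn M a ha *ᵥ cplx B)).re) := by
  rw [DelK_form_eq_formDk, Complex.ofReal_re]
  exact isLeast_actionEta L M k B

/-- **(1.64) reading**: the minimum of `S^η` over `{Q_kA = B}` is «½⟨∂H_kB, ∂H_kB⟩» — `(η^d/2)·cEnergy (H_kB̃)` with the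
(1.21) weight `η^d` — for the tree's minimiser `H_k = B5Hk163Torus.HkOp (L^k) M`.
[cite: Balaban1984PropagatorsI, (1.64) p.29, (1.21) p.21] -/
theorem isLeast_actionEta_HkOp (k : ℕ) (B : Fld M) :
    IsLeast (actionEta L M k '' {A | Qk L M k A = B})
      (eta L k ^ d / 2 * cEnergy (L ^ k) M (HkOp (L ^ k) M *ᵥ cplx B)) := by
  rw [cEnergy_HkOp, eta_half_mul]
  exact isLeast_actionEta L M k B

end Tower

end

end Literature.MathematicalPhysics.QuantumFieldTheory.Balaban1983to89.B5TowerOneStroke
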